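import Summits.QuantumFields.BalabanUV.Beta.FP.StepLawWard

/-!
# `BalabanUV.Beta.FP.StepLawWardRows` — road «FP» for binder row D1: THE ROAD's END FROM THE WALL's ROWS **WITHOUT an2's ROW hR** — `StepLawKHolds` §4∕§5
# with the binder `hRj : ∀ j, AxisReflectionCovariant (flipK (TbalOf … j))` REPLACED by the transposition symmetry of the perfect ONE-step kernel
# `TPerf1 c e t = TPerf1 e c (−t)`; (T0) and the diagonal (T1) come from an1's Ward row `hWj` alone, the transport's Kronecker column is proved

HONEST DEPENDENCY (page 1, mandatory): continuum YM on T⁴ ⇐ BetaPertH ∧ nine spine estimates (0/9 proved); BetaPertH ⇐ (D1) ∧ (D4) ∧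
CAP+tail; G-an2-4 gates asym, D1 and NE2/3/4.  HONEST FRAMING (cell contract, verbatim): «discharging `BetaPertH` makes Bałaban's UV
stability UNCONDITIONAL — a real constructive-QFT result; it is NOT the continuum limit and NOT the Clay problem.»  THIS MODULE DISCHARGES
NOTHING of D1 / BetaPertH: [our object] bookkeeping BY NAME over leaf-06's `StepLawKHolds` ∕ `RoadFromSlots` ∕ `SymmetryInheritHolds` and gen 4's
`StepLawWard`.  No `def`, no `Prop` mirror, no cited fact, 0 sorry; every analytic input is a DISPLAYED hypothesis, none instantiated at a value; 0∕4 binders of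
row D1 discharged; NOT D1, NOT BetaPertH, NOT continuum, NOT Clay.

ABSOLUTE RULE (cell charter, verbatim): «No internally-minted statement may enter as a cited fact. Every hypothesis is either
kernel-proved in this package or a verbatim quotation of a PUBLISHED theorem with page reference. The manuscript(s) under audit are NOT
citable for their own disputed steps — they are the thing under adjudication; programme-internal (2001/route/tribunal) claims are never
citable.»

WHAT CHANGES vs `StepLawKHolds` (leaf-06; road FP's END of record per owner ruling R-FP-1): ONE binder.  There the wall's reflection row `hRj` (an2's hR) is used
once — to give `AxisReflectionCovariant (flipK (TPerf 1))`, hence ALL first moments of the perfect one-step kernel, hence `EntryHyps.T1` of an4's transport.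
Here the step law is `StepLawWard.fPerf_succ_of_fubini_wardFlip_holdsK`: (T0) and the DIAGONAL first moments from `hWj` (inherited to `WardTransversal (flipK
(TPerf 1))` by leaf-06's `wardTransversal_flipK_TPerfOf_one_holdsK`), the Kronecker column proved, and the new displayed socket
`hTsymm : ∀ c e t, TPerf1 c e t = TPerf1 e c (−t)` — Hessian (transposition) symmetry of the perfect one-step polarization kernel, a structural property (table
symmetry + coarse covariance + `bubble_comm`; its supplier is a separate leaf), NOT a reflection law and blind to the rooting.  So road FP's typed residual for
`D1Drift` ∕ `EndpointExistence` reads: pins + S∕W slot rows (row G-an2-4, discharged elsewhere), **`hWj`** (an1's hW), **`hTsymm`**, class data `m ≥ 2`, Fubini∞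
`hfub` + `hDA`, (SDF)∞ `hSDF`, `hasym` (+ `hβ`∕(D4)∕(C)∕`hgen` for the cell END) — an2's hR is NOT an input of road FP.

CONTENT ([our object]): **`fPerf_succ_of_rows_ward_holdsK`**, **`d1Drift_JsBalOf_of_rows_ward_bounded`**, `d1Drift_JsBalOf_of_rows_ward_littleO`,
**`endpointExistence_of_rows_ward_bounded`** — `StepLawKHolds.fPerf_succ_of_rows_holdsK` ∕ `d1Drift_JsBalOf_of_rows_bounded` ∕ `_littleO` ∕
`endpointExistence_of_rows_bounded` VERBATIM with `hRj` ↦ `hTsymm`.  Unit `b2b-balaban-beta-d1-formalise-leaf-02` (gen 4).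
-/

noncomputable section

namespace Summit.QuantumFields.BalabanUV.Beta.FP.StepLawWardRows

open Filter Topology
open Literature.MathematicalPhysics.QuantumFieldTheory
open Literature.MathematicalPhysics.QuantumFieldTheory.Balaban1983to89
open Literature.MathematicalPhysics.QuantumFieldTheory.Balaban1983to89.Beta
open B12Beta (secondMoment)
open B12Normalization (stepBal)
open DecimatedMomentSummable (AbsMoment₂)
open DressedMomentNormalisation (EKer dressedEntry)
open ExpKernelCalculus (MKer Decays VertexFamily₂)
open PolarizationSign (WardTransversal)
open OneStepResolventKernel (Fib LocStencil)
open OneStepKernelFamily (TbalOf flipK D1Drift)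
open BalabanStepJetsSucc (JsBal0Of JsBalOf)
open FlowStep FlowStepRuns DagBinding
open RemainderChain (RemainderConst)
open Summit.QuantumFields.BalabanUV.Beta.HessKerDressedUnits (unitS unitW)
open Summit.QuantumFields.BalabanUV.Beta.GAN24.CombesThomas (sfStep smStep)
open Summit.QuantumFields.BalabanUV.Beta.FP.PerfectObjectsT (KPerf SPerfOf WPerfOf TPerfOf fPerf)
open Summit.QuantumFields.BalabanUV.Beta.FP.TransportInfinityM (colOf)
open Summit.QuantumFields.BalabanUV.Beta.FP.SymmetryInheritHolds (wardTransversal_flipK_TPerfOf_one_holdsK)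
open Summit.QuantumFields.BalabanUV.Beta.FP.RoadFromSlots (exists_limit_rows_of_slots d1Drift_JsBalOf_of_slots_step_law_bounded
  d1Drift_JsBalOf_of_slots_step_law_littleO endpointExistence_of_slots_step_law_bounded)
open Summit.QuantumFields.BalabanUV.Beta.FP.StepLawWard (fPerf_succ_of_fubini_wardFlip_holdsK)

variable {Lc : ℕ} [NeZero Lc] (hLc : 1 ≤ Lc) (cE cVH cΛ : ℝ)
  (W : ℕ → Fin (3 + 1) → (Fin (3 + 1) → ℤ) → Fin (3 + 1) → (Fin (3 + 1) → ℤ) → MKer (3 + 1) (Fib 3))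
  (Cw' δw : ℕ → ℝ) (hδw : ∀ j, 0 < δw j) (hW' : ∀ j, VertexFamily₂ (W j) Lc (Cw' j) (δw j))
  (S : ℕ → ℕ → Fin (3 + 1) → (Fin (3 + 1) → ℤ) → MKer (3 + 1) (Fib 3))
  (Wt : ℕ → ℕ → Fin (3 + 1) → (Fin (3 + 1) → ℤ) → Fin (3 + 1) → (Fin (3 + 1) → ℤ) → MKer (3 + 1) (Fib 3))
  {Cs cS δS θS Cw cW δW θW : ℝ} {D : ℕ → EKer 4}

/-- [our object] **THE STEP LAW OF THE PERFECT COEFFICIENT FAMILY FROM THE WALL's ROWS, K-SIDE UNCONDITIONAL, WITHOUT hR** (`d = 3`, `2 ≤ Lc`, adopted units):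
`StepLawKHolds.fPerf_succ_of_rows_holdsK` with `hRj` REPLACED by the transposition symmetry `hTsymm` of the perfect one-step kernel.  REMAINING (displayed): the
`m = 1` pins and the S- and W-slot Cauchy rows (row G-an2-4); the finite-`j` Ward row `hWj` (an1's hW); `hTsymm`; class data of `SPerfOf … S m` ∕ `WPerfOf … Wt m`
for `m ≥ 2`; Fubini∞ `hfub` + `hDA` (N2a); (SDF)∞ `hSDF` (N2b).  CONCLUSION: the END's `hstep`. -/
theorem fPerf_succ_of_rows_ward_holdsK (hLc2 : 2 ≤ Lc)
    -- the `m = 1` pins and the S- and W-slot Cauchy rows (row G-an2-4, adopted units)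
    (hS1 : ∀ j, S j 1 = (JsBal0Of hLc cE cVH cΛ W Cw' δw hδw hW' j).S) (hW1 : ∀ j, Wt j 1 = W j)
    (hS : ∀ j, LocStencil (unitS (sfStep Lc j) (smStep 3 Lc j) (JsBal0Of hLc cE cVH cΛ W Cw' δw hδw hW' j).S) Cs δS)
    (hSall : ∀ k j, LocStencil (unitS (sfStep Lc (k + j)) (smStep 3 Lc (k + j)) (JsBal0Of hLc cE cVH cΛ W Cw' δw hδw hW' (k + j)).S -
      unitS (sfStep Lc k) (smStep 3 Lc k) (JsBal0Of hLc cE cVH cΛ W Cw' δw hδw hW' k).S) (cS * θS ^ k) δS)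
    (hW : ∀ j, VertexFamily₂ (unitW (sfStep Lc j) (smStep 3 Lc j) (W j)) Lc Cw δW)
    (hWall : ∀ k j, VertexFamily₂ (unitW (sfStep Lc (k + j)) (smStep 3 Lc (k + j)) (W (k + j)) - unitW (sfStep Lc k) (smStep 3 Lc k) (W k)) Lc
      (cW * θW ^ k) δW)
    (hδS : 0 < δS) (hδW : 0 < δW) (hθS0 : 0 ≤ θS) (hθS1 : θS < 1) (hθW0 : 0 ≤ θW) (hθW1 : θW < 1)
    -- the finite-`j` Ward row of the wall family (an1's hW) and the transposition symmetry of the perfect one-step kernel (NO hR)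
    (hWj : ∀ j, WardTransversal (flipK (TbalOf Lc (JsBalOf hLc cE cVH cΛ W Cw' δw hδw hW') j)))
    (hTsymm : ∀ a b t, TPerfOf Lc (KPerf Lc (sfStep Lc) (smStep 3 Lc) 1) (SPerfOf (sfStep Lc) (smStep 3 Lc) S 1)
        (WPerfOf (sfStep Lc) (smStep 3 Lc) Wt 1) a b t
      = TPerfOf Lc (KPerf Lc (sfStep Lc) (smStep 3 Lc) 1) (SPerfOf (sfStep Lc) (smStep 3 Lc) S 1) (WPerfOf (sfStep Lc) (smStep 3 Lc) Wt 1) b a (-t))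
    -- the limit-currency class data of the perfect stencils / tables for `m ≥ 2`
    (hSinf : ∀ m : ℕ, 2 ≤ m → ∃ Cs' δS' : ℝ, 0 < δS' ∧ LocStencil (SPerfOf (sfStep Lc) (smStep 3 Lc) S m) Cs' δS')
    (hWinf : ∀ m : ℕ, 2 ≤ m → ∃ Cw'' δW' : ℝ, 0 < δW' ∧ VertexFamily₂ (WPerfOf (sfStep Lc) (smStep 3 Lc) Wt m) (Lc ^ m) Cw'' δW')
    -- N2a (Fubini∞ with remainder `D`), N2b ((SDF)∞)
    (hDA : ∀ m : ℕ, 1 ≤ m → ∀ a b, AbsMoment₂ (D m a b))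
    (hfub : ∀ m : ℕ, 1 ≤ m → ∀ (a b : Fin 4) (z : Fin 4 → ℤ),
      TPerfOf (Lc ^ (m + 1)) (KPerf Lc (sfStep Lc) (smStep 3 Lc) (m + 1)) (SPerfOf (sfStep Lc) (smStep 3 Lc) S (m + 1))
          (WPerfOf (sfStep Lc) (smStep 3 Lc) Wt (m + 1)) a b z
        = ((Lc ^ m : ℕ) : ℝ) ^ 8 * dressedEntry (colOf (KPerf (d := 3) Lc (sfStep Lc) (smStep 3 Lc) m))
            (TPerfOf Lc (KPerf Lc (sfStep Lc) (smStep 3 Lc) 1) (SPerfOf (sfStep Lc) (smStep 3 Lc) S 1) (WPerfOf (sfStep Lc) (smStep 3 Lc) Wt 1))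
            (((Lc ^ m : ℕ) : ℤ) • z) a b
          + TPerfOf (Lc ^ m) (KPerf Lc (sfStep Lc) (smStep 3 Lc) m) (SPerfOf (sfStep Lc) (smStep 3 Lc) S m) (WPerfOf (sfStep Lc) (smStep 3 Lc) Wt m) a b z
          + D m a b z)
    (μ ν : Fin 4) (hSDF : ∀ m : ℕ, 1 ≤ m → secondMoment (D m) μ ν = 0) :
    ∀ m : ℕ, 1 ≤ m → fPerf Lc (sfStep Lc) (smStep 3 Lc) S Wt μ ν (m + 1) =
      fPerf Lc (sfStep Lc) (smStep 3 Lc) S Wt μ ν m + fPerf Lc (sfStep Lc) (smStep 3 Lc) S Wt μ ν 1 := by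
  -- the `m = 1` class data of the perfect stencil / tables from the slot rows
  obtain ⟨C, δK, cK, θ, R, hR, hRK, hRS, hRW, hθ0, hθ1, -, -, -, hSinf1, -, hWinf1, -⟩ :=
    exists_limit_rows_of_slots hLc cE cVH cΛ W Cw' δw hδw hW' S Wt hLc2 hS1 hW1 hS hSall hW hWall hδS hδW hθS0 hθS1 hθW0 hθW1
  have hSinf' : ∀ m : ℕ, 1 ≤ m → ∃ Cs' δS' : ℝ, 0 < δS' ∧ LocStencil (SPerfOf (sfStep Lc) (smStep 3 Lc) S m) Cs' δS' := fun m hm => by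
    rcases Nat.eq_or_lt_of_le hm with h1 | h2
    · exact ⟨Cs, δS, hδS, h1 ▸ hSinf1⟩
    · exact hSinf m h2
  have hWinf' : ∀ m : ℕ, 1 ≤ m → ∃ Cw'' δW' : ℝ, 0 < δW' ∧ VertexFamily₂ (WPerfOf (sfStep Lc) (smStep 3 Lc) Wt m) (Lc ^ m) Cw'' δW' :=
    fun m hm => by
    rcases Nat.eq_or_lt_of_le hm with h1 | h2
    · refine ⟨Cw, δW, hδW, ?_⟩
      rw [← h1, pow_one]
      exact hWinf1
    · exact hWinf m h2
  exact fPerf_succ_of_fubini_wardFlip_holdsK S Wt hLc2 hSinf' hWinf'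
    (wardTransversal_flipK_TPerfOf_one_holdsK hLc cE cVH cΛ W Cw' δw hδw hW' S Wt hLc2 hS1 hW1 hS hSall hW hWall hδS hδW hθS0 hθS1 hθW0 hθW1 hWj)
    hTsymm hDA hfub μ ν hSDF

/-- [our object] **ROAD «FP», THE END FROM THE WALL's ROWS WITHOUT hR (bounded-defect form)** (`d = 3`, `2 ≤ Lc`, adopted units):
`StepLawKHolds.d1Drift_JsBalOf_of_rows_bounded` with `hRj` ↦ `hTsymm` ⊢ `D1Drift Lc (JsBalOf …) N μ ν`.  NOT «D1 closed»: `hWj` is one of the four binders of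
`d1Drift_of_D1Tel_D1Rep`, `hTsymm` is a displayed socket, N2a∕N2b∕N7 are open leaves, the slots are row G-an2-4. -/
theorem d1Drift_JsBalOf_of_rows_ward_bounded (hLc2 : 2 ≤ Lc)
    (hS1 : ∀ j, S j 1 = (JsBal0Of hLc cE cVH cΛ W Cw' δw hδw hW' j).S) (hW1 : ∀ j, Wt j 1 = W j)
    (hS : ∀ j, LocStencil (unitS (sfStep Lc j) (smStep 3 Lc j) (JsBal0Of hLc cE cVH cΛ W Cw' δw hδw hW' j).S) Cs δS)
    (hSall : ∀ k j, LocStencil (unitS (sfStep Lc (k + j)) (smStep 3 Lc (k + j)) (JsBal0Of hLc cE cVH cΛ W Cw' δw hδw hW' (k + j)).S -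
      unitS (sfStep Lc k) (smStep 3 Lc k) (JsBal0Of hLc cE cVH cΛ W Cw' δw hδw hW' k).S) (cS * θS ^ k) δS)
    (hW : ∀ j, VertexFamily₂ (unitW (sfStep Lc j) (smStep 3 Lc j) (W j)) Lc Cw δW)
    (hWall : ∀ k j, VertexFamily₂ (unitW (sfStep Lc (k + j)) (smStep 3 Lc (k + j)) (W (k + j)) - unitW (sfStep Lc k) (smStep 3 Lc k) (W k)) Lc
      (cW * θW ^ k) δW)
    (hδS : 0 < δS) (hδW : 0 < δW) (hθS0 : 0 ≤ θS) (hθS1 : θS < 1) (hθW0 : 0 ≤ θW) (hθW1 : θW < 1)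
    (hWj : ∀ j, WardTransversal (flipK (TbalOf Lc (JsBalOf hLc cE cVH cΛ W Cw' δw hδw hW') j)))
    (hTsymm : ∀ a b t, TPerfOf Lc (KPerf Lc (sfStep Lc) (smStep 3 Lc) 1) (SPerfOf (sfStep Lc) (smStep 3 Lc) S 1)
        (WPerfOf (sfStep Lc) (smStep 3 Lc) Wt 1) a b t
      = TPerfOf Lc (KPerf Lc (sfStep Lc) (smStep 3 Lc) 1) (SPerfOf (sfStep Lc) (smStep 3 Lc) S 1) (WPerfOf (sfStep Lc) (smStep 3 Lc) Wt 1) b a (-t))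
    (hSinf : ∀ m : ℕ, 2 ≤ m → ∃ Cs' δS' : ℝ, 0 < δS' ∧ LocStencil (SPerfOf (sfStep Lc) (smStep 3 Lc) S m) Cs' δS')
    (hWinf : ∀ m : ℕ, 2 ≤ m → ∃ Cw'' δW' : ℝ, 0 < δW' ∧ VertexFamily₂ (WPerfOf (sfStep Lc) (smStep 3 Lc) Wt m) (Lc ^ m) Cw'' δW')
    (hDA : ∀ m : ℕ, 1 ≤ m → ∀ a b, AbsMoment₂ (D m a b))
    (hfub : ∀ m : ℕ, 1 ≤ m → ∀ (a b : Fin 4) (z : Fin 4 → ℤ),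
      TPerfOf (Lc ^ (m + 1)) (KPerf Lc (sfStep Lc) (smStep 3 Lc) (m + 1)) (SPerfOf (sfStep Lc) (smStep 3 Lc) S (m + 1))
          (WPerfOf (sfStep Lc) (smStep 3 Lc) Wt (m + 1)) a b z
        = ((Lc ^ m : ℕ) : ℝ) ^ 8 * dressedEntry (colOf (KPerf (d := 3) Lc (sfStep Lc) (smStep 3 Lc) m))
            (TPerfOf Lc (KPerf Lc (sfStep Lc) (smStep 3 Lc) 1) (SPerfOf (sfStep Lc) (smStep 3 Lc) S 1) (WPerfOf (sfStep Lc) (smStep 3 Lc) Wt 1))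
            (((Lc ^ m : ℕ) : ℤ) • z) a b
          + TPerfOf (Lc ^ m) (KPerf Lc (sfStep Lc) (smStep 3 Lc) m) (SPerfOf (sfStep Lc) (smStep 3 Lc) S m) (WPerfOf (sfStep Lc) (smStep 3 Lc) Wt m) a b z
          + D m a b z)
    (μ ν : Fin 4) (hSDF : ∀ m : ℕ, 1 ≤ m → secondMoment (D m) μ ν = 0) {N Cg : ℝ}
    (hasym : ∀ m : ℕ, 1 ≤ m → |fPerf Lc (sfStep Lc) (smStep 3 Lc) S Wt μ ν m - (m : ℝ) * stepBal N Lc| ≤ Cg) :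
    D1Drift Lc (JsBalOf hLc cE cVH cΛ W Cw' δw hδw hW') N μ ν :=
  d1Drift_JsBalOf_of_slots_step_law_bounded hLc cE cVH cΛ W Cw' δw hδw hW' S Wt hLc2 hS1 hW1 hS hSall hW hWall hδS hδW hθS0 hθS1 hθW0 hθW1 μ ν
    (fPerf_succ_of_rows_ward_holdsK hLc cE cVH cΛ W Cw' δw hδw hW' S Wt hLc2 hS1 hW1 hS hSall hW hWall hδS hδW hθS0 hθS1 hθW0 hθW1 hWj hTsymm hSinf
      hWinf hDA hfub μ ν hSDF)
    hasym

/-- [our object] **ROAD «FP», THE END FROM THE WALL's ROWS WITHOUT hR (mean-law form)**: as above with the asymptotic input weakened to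
`(fPerf m − m·stepBal N Lc)/m → 0`. -/
theorem d1Drift_JsBalOf_of_rows_ward_littleO (hLc2 : 2 ≤ Lc)
    (hS1 : ∀ j, S j 1 = (JsBal0Of hLc cE cVH cΛ W Cw' δw hδw hW' j).S) (hW1 : ∀ j, Wt j 1 = W j)
    (hS : ∀ j, LocStencil (unitS (sfStep Lc j) (smStep 3 Lc j) (JsBal0Of hLc cE cVH cΛ W Cw' δw hδw hW' j).S) Cs δS)
    (hSall : ∀ k j, LocStencil (unitS (sfStep Lc (k + j)) (smStep 3 Lc (k + j)) (JsBal0Of hLc cE cVH cΛ W Cw' δw hδw hW' (k + j)).S -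
      unitS (sfStep Lc k) (smStep 3 Lc k) (JsBal0Of hLc cE cVH cΛ W Cw' δw hδw hW' k).S) (cS * θS ^ k) δS)
    (hW : ∀ j, VertexFamily₂ (unitW (sfStep Lc j) (smStep 3 Lc j) (W j)) Lc Cw δW)
    (hWall : ∀ k j, VertexFamily₂ (unitW (sfStep Lc (k + j)) (smStep 3 Lc (k + j)) (W (k + j)) - unitW (sfStep Lc k) (smStep 3 Lc k) (W k)) Lc
      (cW * θW ^ k) δW)
    (hδS : 0 < δS) (hδW : 0 < δW) (hθS0 : 0 ≤ θS) (hθS1 : θS < 1) (hθW0 : 0 ≤ θW) (hθW1 : θW < 1)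
    (hWj : ∀ j, WardTransversal (flipK (TbalOf Lc (JsBalOf hLc cE cVH cΛ W Cw' δw hδw hW') j)))
    (hTsymm : ∀ a b t, TPerfOf Lc (KPerf Lc (sfStep Lc) (smStep 3 Lc) 1) (SPerfOf (sfStep Lc) (smStep 3 Lc) S 1)
        (WPerfOf (sfStep Lc) (smStep 3 Lc) Wt 1) a b t
      = TPerfOf Lc (KPerf Lc (sfStep Lc) (smStep 3 Lc) 1) (SPerfOf (sfStep Lc) (smStep 3 Lc) S 1) (WPerfOf (sfStep Lc) (smStep 3 Lc) Wt 1) b a (-t))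
    (hSinf : ∀ m : ℕ, 2 ≤ m → ∃ Cs' δS' : ℝ, 0 < δS' ∧ LocStencil (SPerfOf (sfStep Lc) (smStep 3 Lc) S m) Cs' δS')
    (hWinf : ∀ m : ℕ, 2 ≤ m → ∃ Cw'' δW' : ℝ, 0 < δW' ∧ VertexFamily₂ (WPerfOf (sfStep Lc) (smStep 3 Lc) Wt m) (Lc ^ m) Cw'' δW')
    (hDA : ∀ m : ℕ, 1 ≤ m → ∀ a b, AbsMoment₂ (D m a b))
    (hfub : ∀ m : ℕ, 1 ≤ m → ∀ (a b : Fin 4) (z : Fin 4 → ℤ),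
      TPerfOf (Lc ^ (m + 1)) (KPerf Lc (sfStep Lc) (smStep 3 Lc) (m + 1)) (SPerfOf (sfStep Lc) (smStep 3 Lc) S (m + 1))
          (WPerfOf (sfStep Lc) (smStep 3 Lc) Wt (m + 1)) a b z
        = ((Lc ^ m : ℕ) : ℝ) ^ 8 * dressedEntry (colOf (KPerf (d := 3) Lc (sfStep Lc) (smStep 3 Lc) m))
            (TPerfOf Lc (KPerf Lc (sfStep Lc) (smStep 3 Lc) 1) (SPerfOf (sfStep Lc) (smStep 3 Lc) S 1) (WPerfOf (sfStep Lc) (smStep 3 Lc) Wt 1))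
            (((Lc ^ m : ℕ) : ℤ) • z) a b
          + TPerfOf (Lc ^ m) (KPerf Lc (sfStep Lc) (smStep 3 Lc) m) (SPerfOf (sfStep Lc) (smStep 3 Lc) S m) (WPerfOf (sfStep Lc) (smStep 3 Lc) Wt m) a b z
          + D m a b z)
    (μ ν : Fin 4) (hSDF : ∀ m : ℕ, 1 ≤ m → secondMoment (D m) μ ν = 0) {N : ℝ}
    (hasym : Tendsto (fun m : ℕ => (fPerf Lc (sfStep Lc) (smStep 3 Lc) S Wt μ ν m - (m : ℝ) * stepBal N Lc) / (m : ℝ)) atTop (𝓝 0)) :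
    D1Drift Lc (JsBalOf hLc cE cVH cΛ W Cw' δw hδw hW') N μ ν :=
  d1Drift_JsBalOf_of_slots_step_law_littleO hLc cE cVH cΛ W Cw' δw hδw hW' S Wt hLc2 hS1 hW1 hS hSall hW hWall hδS hδW hθS0 hθS1 hθW0 hθW1 μ ν
    (fPerf_succ_of_rows_ward_holdsK hLc cE cVH cΛ W Cw' δw hδw hW' S Wt hLc2 hS1 hW1 hS hSall hW hWall hδS hδW hθS0 hθS1 hθW0 hθW1 hWj hTsymm hSinf
      hWinf hDA hfub μ ν hSDF)
    hasym

/-- [our object] **THE CELL's END STATEMENT FROM ROAD «FP» AND THE WALL's ROWS, WITHOUT hR**: `StepLawKHolds.endpointExistence_of_rows_bounded` with `hRj` ↦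
`hTsymm` — `EndpointExistence Cn` BY TYPE from the S- and W-slot rows, the pins, `hWj`, `hTsymm`, class data (`m ≥ 2`), Fubini∞, (SDF)∞, bounded-defect
asymptotics, `hβ`, (D4) `RemainderConst` with `rr ≤ stepBal`, (C), `hgen`.  NOT the continuum limit's construction: every analytic input is a HYPOTHESIS. -/
theorem endpointExistence_of_rows_ward_bounded (hLc2 : 2 ≤ Lc)
    (hS1 : ∀ j, S j 1 = (JsBal0Of hLc cE cVH cΛ W Cw' δw hδw hW' j).S) (hW1 : ∀ j, Wt j 1 = W j)
    (hS : ∀ j, LocStencil (unitS (sfStep Lc j) (smStep 3 Lc j) (JsBal0Of hLc cE cVH cΛ W Cw' δw hδw hW' j).S) Cs δS)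
    (hSall : ∀ k j, LocStencil (unitS (sfStep Lc (k + j)) (smStep 3 Lc (k + j)) (JsBal0Of hLc cE cVH cΛ W Cw' δw hδw hW' (k + j)).S -
      unitS (sfStep Lc k) (smStep 3 Lc k) (JsBal0Of hLc cE cVH cΛ W Cw' δw hδw hW' k).S) (cS * θS ^ k) δS)
    (hW : ∀ j, VertexFamily₂ (unitW (sfStep Lc j) (smStep 3 Lc j) (W j)) Lc Cw δW)
    (hWall : ∀ k j, VertexFamily₂ (unitW (sfStep Lc (k + j)) (smStep 3 Lc (k + j)) (W (k + j)) - unitW (sfStep Lc k) (smStep 3 Lc k) (W k)) Lc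
      (cW * θW ^ k) δW)
    (hδS : 0 < δS) (hδW : 0 < δW) (hθS0 : 0 ≤ θS) (hθS1 : θS < 1) (hθW0 : 0 ≤ θW) (hθW1 : θW < 1)
    (hWj : ∀ j, WardTransversal (flipK (TbalOf Lc (JsBalOf hLc cE cVH cΛ W Cw' δw hδw hW') j)))
    (hTsymm : ∀ a b t, TPerfOf Lc (KPerf Lc (sfStep Lc) (smStep 3 Lc) 1) (SPerfOf (sfStep Lc) (smStep 3 Lc) S 1)
        (WPerfOf (sfStep Lc) (smStep 3 Lc) Wt 1) a b t
      = TPerfOf Lc (KPerf Lc (sfStep Lc) (smStep 3 Lc) 1) (SPerfOf (sfStep Lc) (smStep 3 Lc) S 1) (WPerfOf (sfStep Lc) (smStep 3 Lc) Wt 1) b a (-t))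
    (hSinf : ∀ m : ℕ, 2 ≤ m → ∃ Cs' δS' : ℝ, 0 < δS' ∧ LocStencil (SPerfOf (sfStep Lc) (smStep 3 Lc) S m) Cs' δS')
    (hWinf : ∀ m : ℕ, 2 ≤ m → ∃ Cw'' δW' : ℝ, 0 < δW' ∧ VertexFamily₂ (WPerfOf (sfStep Lc) (smStep 3 Lc) Wt m) (Lc ^ m) Cw'' δW')
    (hDA : ∀ m : ℕ, 1 ≤ m → ∀ a b, AbsMoment₂ (D m a b))
    (hfub : ∀ m : ℕ, 1 ≤ m → ∀ (a b : Fin 4) (z : Fin 4 → ℤ),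
      TPerfOf (Lc ^ (m + 1)) (KPerf Lc (sfStep Lc) (smStep 3 Lc) (m + 1)) (SPerfOf (sfStep Lc) (smStep 3 Lc) S (m + 1))
          (WPerfOf (sfStep Lc) (smStep 3 Lc) Wt (m + 1)) a b z
        = ((Lc ^ m : ℕ) : ℝ) ^ 8 * dressedEntry (colOf (KPerf (d := 3) Lc (sfStep Lc) (smStep 3 Lc) m))
            (TPerfOf Lc (KPerf Lc (sfStep Lc) (smStep 3 Lc) 1) (SPerfOf (sfStep Lc) (smStep 3 Lc) S 1) (WPerfOf (sfStep Lc) (smStep 3 Lc) Wt 1))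
            (((Lc ^ m : ℕ) : ℤ) • z) a b
          + TPerfOf (Lc ^ m) (KPerf Lc (sfStep Lc) (smStep 3 Lc) m) (SPerfOf (sfStep Lc) (smStep 3 Lc) S m) (WPerfOf (sfStep Lc) (smStep 3 Lc) Wt m) a b z
          + D m a b z)
    (μ ν : Fin 4) (hSDF : ∀ m : ℕ, 1 ≤ m → secondMoment (D m) μ ν = 0) {N Cg : ℝ}
    (hasym : ∀ m : ℕ, 1 ≤ m → |fPerf Lc (sfStep Lc) (smStep 3 Lc) S Wt μ ν m - (m : ℝ) * stepBal N Lc| ≤ Cg)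
    {β : HBeta} {Cn : B12.Construction} (hgen : ForwardGenerated Cn β) (Sβ : B12Beta.OneLoopSplit β)
    (hβ : ∀ j, Sβ.β0 j = B12Beta.secondMoment (TbalOf Lc (JsBalOf hLc cE cVH cΛ W Cw' δw hδw hW') j) μ ν)
    {rr γ₀ : ℝ} (hγ₀ : 0 < γ₀) (hrem : RemainderConst Sβ γ₀ rr) (hr : rr ≤ stepBal N Lc) (hcont : BetaContH γ₀ β) :
    EndpointExistence Cn :=
  endpointExistence_of_slots_step_law_bounded hLc cE cVH cΛ W Cw' δw hδw hW' S Wt hLc2 hS1 hW1 hS hSall hW hWall hδS hδW hθS0 hθS1 hθW0 hθW1 μ ν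
    (fPerf_succ_of_rows_ward_holdsK hLc cE cVH cΛ W Cw' δw hδw hW' S Wt hLc2 hS1 hW1 hS hSall hW hWall hδS hδW hθS0 hθS1 hθW0 hθW1 hWj hTsymm hSinf
      hWinf hDA hfub μ ν hSDF)
    hasym hgen Sβ hβ hγ₀ hrem hr hcont

end Summit.QuantumFields.BalabanUV.Beta.FP.StepLawWardRows

end
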